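import Mathlib.Analysis.MeanInequalities
import Mathlib.Analysis.SpecialFunctions.Pow.Real
import HarnessLib

/-!
# Tangent rows of the convex bootstrap are valid: the weighted AM–GM behind every Kelley cut (lane prim-rate, constants-miner 1, gen 26; RIGOROUS-CERTIFICATION.md §1)

Support file for the closed crux `NoHeavyLowerTail` (stmt-CriticalPhenomena-4575), majority-gluing line.  Every certificate of the
lane's convex programmes (THEOREMS BOTTOM-2 and BOTTOM-3, the fixed-`M` window points) is a non-negative combination of LINEAR rows and of
TANGENT ROWS of concave power constraints `u ≤ C·∏ s_j^{q}`; the exact audit (census/g26) re-derives each tangent row at its recorded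
support point with outward rounding.  What makes a tangent row VALID for every non-negative law is the weighted AM–GM inequality;
this file proves the four shapes that occur, in the form the certificates use them (support point `a, b, …  > 0`, arbitrary
`s, t, … ≥ 0`, and — for the rounded rows — any constants `h, g_j` at least the true tangent data):
* `tangent_one`   — one support, exponent `q ∈ (0,1]` (STAR rows):            `s^q ≤ a^q·((1−q) + q·s/a)`;
* `tangent_two`   — two supports, exponent `q` each, `2q ≤ 1` (hub / relay ISO₃, ISO₄ and ISO₅ rows): `(s t)^q ≤ (a b)^q·((1−2q) + q·s/a + q·t/b)`;
* `tangent_three` — three supports, `3q ≤ 1` (the tightened symmetric relay / 4-set rows, `q = 8/25`; the GM₃ objective, `q = 1/3`);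
* `tangent_four`  — four supports with `q = 1/4` (the GM₄ objective of world A): `(s t u v)^{1/4} ≤ (a b c d)^{1/4}·(s/a + t/b + u/c + v/d)/4`;
* `tangent_two_rounded` — the rounded row: `C(st)^q ≤ h + g₁ s + g₂ t` whenever `h ≥ C(ab)^q(1−2q)`, `g₁ ≥ C q (ab)^q/a`, `g₂ ≥ C q (ab)^q/b`.
Pure real analysis (Mathlib's `Real.geom_mean_le_arith_mean{2,3,4}_weighted`); no percolation, no definitions, no sorries.
[cite: VandenbergHaggstromKahn2005, Thm. 1.3 (p. 6)]
-/

noncomputable section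

namespace Summit.CriticalPhenomena.PercolationContinuityZ3.Theorems

namespace HubOnly
namespace ConvexBootstrap

open Real

/-- **One support.**  For `0 ≤ q ≤ 1`, `0 < a`, `0 ≤ s`:  `s^q ≤ a^q·((1 − q) + q·(s/a))` — the tangent of the concave `s ↦ s^q` at `a`. -/
theorem tangent_one {q a s : ℝ} (hq0 : 0 ≤ q) (hq1 : q ≤ 1) (ha : 0 < a) (hs : 0 ≤ s) :
    s ^ q ≤ a ^ q * ((1 - q) + q * (s / a)) := by
  have hsa : 0 ≤ s / a := div_nonneg hs (le_of_lt ha)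
  have key := Real.geom_mean_le_arith_mean2_weighted (w₁ := q) (w₂ := 1 - q) (p₁ := s / a) (p₂ := 1)
    hq0 (by linarith) hsa zero_le_one (by ring)
  rw [Real.one_rpow, mul_one] at key
  -- s^q = a^q (s/a)^q
  have hsplit : s ^ q = a ^ q * (s / a) ^ q := by
    rw [← Real.mul_rpow (le_of_lt ha) hsa]; congr 1; field_simp
  rw [hsplit]
  have haq : 0 ≤ a ^ q := le_of_lt (Real.rpow_pos_of_pos ha q)
  have : a ^ q * (s / a) ^ q ≤ a ^ q * (q * (s / a) + (1 - q) * 1) := mul_le_mul_of_nonneg_left key haq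
  linarith [this]

/-- **Two supports.**  For `0 ≤ q`, `2q ≤ 1`, `0 < a, b`, `0 ≤ s, t`:  `(s·t)^q ≤ (a·b)^q·((1 − 2q) + q·(s/a) + q·(t/b))` — the
tangent plane of the concave `(s,t) ↦ (st)^q` at `(a,b)` (hub and relay ISO₃ rows with `q = 1/c₃`, ISO₄ rows with `q = 1/c₄`, ISO₅ with `q = 2/5`). -/
theorem tangent_two {q a b s t : ℝ} (hq0 : 0 ≤ q) (hq2 : 2 * q ≤ 1) (ha : 0 < a) (hb : 0 < b)
    (hs : 0 ≤ s) (ht : 0 ≤ t) :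
    (s * t) ^ q ≤ (a * b) ^ q * ((1 - 2 * q) + q * (s / a) + q * (t / b)) := by
  have hsa : 0 ≤ s / a := div_nonneg hs (le_of_lt ha)
  have htb : 0 ≤ t / b := div_nonneg ht (le_of_lt hb)
  have key := Real.geom_mean_le_arith_mean3_weighted (w₁ := q) (w₂ := q) (w₃ := 1 - 2 * q)
    (p₁ := s / a) (p₂ := t / b) (p₃ := 1) hq0 hq0 (by linarith) hsa htb zero_le_one (by ring)
  rw [Real.one_rpow, mul_one] at key
  have hsplit : (s * t) ^ q = (a * b) ^ q * ((s / a) ^ q * (t / b) ^ q) := by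
    rw [← Real.mul_rpow hsa htb, ← Real.mul_rpow (le_of_lt (mul_pos ha hb)) (mul_nonneg hsa htb)]
    congr 1; field_simp
  rw [hsplit]
  have habq : 0 ≤ (a * b) ^ q := le_of_lt (Real.rpow_pos_of_pos (mul_pos ha hb) q)
  have := mul_le_mul_of_nonneg_left key habq
  linarith [this]

/-- **Three supports.**  For `0 ≤ q`, `3q ≤ 1`, positive support point and non-negative arguments:
`(s·t·u)^q ≤ (a·b·c)^q·((1 − 3q) + q·(s/a) + q·(t/b) + q·(u/c))` (the symmetric tightened rows, `q = 8/25`; the GM₃ objective, `q = 1/3`). -/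
theorem tangent_three {q a b c s t u : ℝ} (hq0 : 0 ≤ q) (hq3 : 3 * q ≤ 1) (ha : 0 < a) (hb : 0 < b)
    (hc : 0 < c) (hs : 0 ≤ s) (ht : 0 ≤ t) (hu : 0 ≤ u) :
    (s * t * u) ^ q ≤ (a * b * c) ^ q * ((1 - 3 * q) + q * (s / a) + q * (t / b) + q * (u / c)) := by
  have hsa : 0 ≤ s / a := div_nonneg hs (le_of_lt ha)
  have htb : 0 ≤ t / b := div_nonneg ht (le_of_lt hb)
  have huc : 0 ≤ u / c := div_nonneg hu (le_of_lt hc)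
  have key := Real.geom_mean_le_arith_mean4_weighted (w₁ := q) (w₂ := q) (w₃ := q) (w₄ := 1 - 3 * q)
    (p₁ := s / a) (p₂ := t / b) (p₃ := u / c) (p₄ := 1) hq0 hq0 hq0 (by linarith) hsa htb huc zero_le_one (by ring)
  rw [Real.one_rpow, mul_one] at key
  have habc : 0 < a * b * c := mul_pos (mul_pos ha hb) hc
  have hsplit : (s * t * u) ^ q = (a * b * c) ^ q * ((s / a) ^ q * (t / b) ^ q * (u / c) ^ q) := by
    rw [← Real.mul_rpow hsa htb, ← Real.mul_rpow (mul_nonneg hsa htb) huc,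
      ← Real.mul_rpow (le_of_lt habc) (mul_nonneg (mul_nonneg hsa htb) huc)]
    congr 1; field_simp
  rw [hsplit]
  have habcq : 0 ≤ (a * b * c) ^ q := le_of_lt (Real.rpow_pos_of_pos habc q)
  have := mul_le_mul_of_nonneg_left key habcq
  linarith [this]

/-- **Four supports, exponent 1/4** (the degree-one GM₄ objective of world A; `1 − 4q = 0`):
`(s·t·u·v)^{1/4} ≤ (a·b·c·d)^{1/4}·((s/a) + (t/b) + (u/c) + (v/d))/4`. -/
theorem tangent_four {a b c d s t u v : ℝ} (ha : 0 < a) (hb : 0 < b) (hc : 0 < c) (hd : 0 < d)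
    (hs : 0 ≤ s) (ht : 0 ≤ t) (hu : 0 ≤ u) (hv : 0 ≤ v) :
    (s * t * u * v) ^ (1 / 4 : ℝ) ≤ (a * b * c * d) ^ (1 / 4 : ℝ) * ((s / a + t / b + u / c + v / d) / 4) := by
  have hsa : 0 ≤ s / a := div_nonneg hs (le_of_lt ha)
  have htb : 0 ≤ t / b := div_nonneg ht (le_of_lt hb)
  have huc : 0 ≤ u / c := div_nonneg hu (le_of_lt hc)
  have hvd : 0 ≤ v / d := div_nonneg hv (le_of_lt hd)
  have key := Real.geom_mean_le_arith_mean4_weighted (w₁ := 1 / 4) (w₂ := 1 / 4) (w₃ := 1 / 4) (w₄ := 1 / 4)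
    (p₁ := s / a) (p₂ := t / b) (p₃ := u / c) (p₄ := v / d) (by norm_num) (by norm_num) (by norm_num) (by norm_num)
    hsa htb huc hvd (by norm_num)
  have habcd : 0 < a * b * c * d := mul_pos (mul_pos (mul_pos ha hb) hc) hd
  have hsplit : (s * t * u * v) ^ (1 / 4 : ℝ) =
      (a * b * c * d) ^ (1 / 4 : ℝ) * ((s / a) ^ (1 / 4 : ℝ) * (t / b) ^ (1 / 4 : ℝ) * (u / c) ^ (1 / 4 : ℝ) * (v / d) ^ (1 / 4 : ℝ)) := by
    rw [← Real.mul_rpow hsa htb, ← Real.mul_rpow (mul_nonneg hsa htb) huc,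
      ← Real.mul_rpow (mul_nonneg (mul_nonneg hsa htb) huc) hvd,
      ← Real.mul_rpow (le_of_lt habcd) (mul_nonneg (mul_nonneg (mul_nonneg hsa htb) huc) hvd)]
    congr 1; field_simp
  rw [hsplit]
  have hq : 0 ≤ (a * b * c * d) ^ (1 / 4 : ℝ) := le_of_lt (Real.rpow_pos_of_pos habcd _)
  have := mul_le_mul_of_nonneg_left key hq
  linarith [this]

/-- **The rounded tangent row is valid.**  If `C ≥ 0` and the emitted constants dominate the true tangent data at the support point
`(a,b)` — `h ≥ C·(ab)^q·(1 − 2q)`, `g₁ ≥ C·q·(ab)^q/a`, `g₂ ≥ C·q·(ab)^q/b` — then for ALL `s, t ≥ 0`: `C·(s·t)^q ≤ h + g₁·s + g₂·t`.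
This is exactly the direction of rounding used by the exact audit (coefficients of the support variables rounded so that the row only weakens). -/
theorem tangent_two_rounded {q a b s t C h g₁ g₂ : ℝ} (hq0 : 0 ≤ q) (hq2 : 2 * q ≤ 1) (ha : 0 < a) (hb : 0 < b)
    (hs : 0 ≤ s) (ht : 0 ≤ t) (hC : 0 ≤ C)
    (hh : C * (a * b) ^ q * (1 - 2 * q) ≤ h) (hg₁ : C * q * (a * b) ^ q / a ≤ g₁) (hg₂ : C * q * (a * b) ^ q / b ≤ g₂) :
    C * (s * t) ^ q ≤ h + g₁ * s + g₂ * t := by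
  have htan := tangent_two hq0 hq2 ha hb hs ht
  have h1 : C * (s * t) ^ q ≤ C * ((a * b) ^ q * ((1 - 2 * q) + q * (s / a) + q * (t / b))) :=
    mul_le_mul_of_nonneg_left htan hC
  have e : C * ((a * b) ^ q * ((1 - 2 * q) + q * (s / a) + q * (t / b))) =
      C * (a * b) ^ q * (1 - 2 * q) + (C * q * (a * b) ^ q / a) * s + (C * q * (a * b) ^ q / b) * t := by
    field_simp
  rw [e] at h1
  have h2 : (C * q * (a * b) ^ q / a) * s ≤ g₁ * s := mul_le_mul_of_nonneg_right hg₁ hs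
  have h3 : (C * q * (a * b) ^ q / b) * t ≤ g₂ * t := mul_le_mul_of_nonneg_right hg₂ ht
  linarith

end ConvexBootstrap
end HubOnly

end Summit.CriticalPhenomena.PercolationContinuityZ3.Theorems
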